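import Mathlib
import Summits.ResolutionOfSingularities.ResolutionOfSingularities.Theses.DefectlessFrames
import Literature.AlgebraicGeometry.Resolution.TranscendenceDefect

/-!
# Sketch — first lemmas of the crux ideas for `PureTranscendentalFrames` (stmt-…-18874)

Card A `split-shadow-criterion` : `isPTPure_of_dense`, `isPTPure_of_cyclic`,
  `isPTPure_of_forall_exists_le`, `isPTPure_of_transcendenceDefect_eq_zero`.
Card B `additive-datum-repointing` : `no_two_cycle`, `isPTPure_sub_left_iff`.

Everything is stated in the crux's own rendering (`k`, `K`, `O : ValuationSubring K`,
`K₁ : IntermediateField k K`, multiplicative values `O.valuation`). Proofs are NOT claimed here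
(sorries); the file only certifies that the signatures elaborate.
-/

open Polynomial

namespace Summit.ResolutionOfSingularities.ResolutionOfSingularities.Cruxes.PureTranscendentalFrames.Sketch

variable {k K : Type} [Field k] [Field K] [Algebra k K]

/-- PT's purity clause for `w` over the block field `K₁` — verbatim shape of the last conjunct of
`Theses.DefectlessFrames.PureTranscendentalFrames`: (a) the distance `v(w − K₁)` is attained, or
(b) every non-zero `q ∈ K₁[X]` has `v(q(w) − q(a)) > v(q(w))` for some `a ∈ K₁`. -/
def IsPTPure (O : ValuationSubring K) (K₁ : IntermediateField k K) (w : K) : Prop :=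
  (∃ h ∈ K₁, ∀ a ∈ K₁, O.valuation (w - h) ≤ O.valuation (w - a)) ∨
  (∀ q : Polynomial K₁, q ≠ 0 → ∃ a : K₁,
      O.valuation (Polynomial.aeval w q - algebraMap K₁ K (Polynomial.eval a q)) <
        O.valuation (Polynomial.aeval w q))

/-! ### Card A — the split/shadow criterion and coarse blocks -/

/-- **A0 (absorption endpoint).** If `w` lies in the closure of `K₁` (every ball around `w` meets
`K₁`: `w` is in the completion of the block field) and `w` is transcendental over `K₁`, then
disjunct (b) holds by continuity of polynomials. [Knaf–Kuhlmann 2009, Lemma 2.16, second case;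
Kuhlmann 2022 (approximation types), Prop. 3.19] -/
theorem isPTPure_of_dense (O : ValuationSubring K) (K₁ : IntermediateField k K) {w : K}
    (hw : Transcendental K₁ w)
    (hdense : ∀ γ : (ValuationSubring.ValueGroup O)ˣ, ∃ a ∈ K₁, O.valuation (w - a) < γ) :
    IsPTPure O K₁ w := by
  sorry

/-- **A1 (discrete block ⇒ pure).** If the value group of the block field `K₁` is cyclic
(generated by `v π`) and `O` has rank one, then EVERY `w` transcendental over `K₁` is PT-pure:
the non-maximal values `v(w − a)` lie in `v(K₁ˣ) = ⟨v π⟩`, a bounded strictly monotone sequence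
there is finite (archimedean), so either the distance is attained (a) or `w` is a Cauchy limit
from `K₁` and `isPTPure_of_dense` gives (b). Generalises the refuter's `n ≤ 1` observation to all
dimensions (every discretely valued block, e.g. all frames of a DVR-type zero-dimensional
valuation, F. K. Schmidt defect notwithstanding). -/
theorem isPTPure_of_cyclic (O : ValuationSubring K) [O.valuation.RankOne]
    (K₁ : IntermediateField k K) {π : K} (hπ : π ∈ K₁)
    (hcyc : ∀ a ∈ K₁, a ≠ 0 → ∃ m : ℤ, O.valuation a = O.valuation π ^ m)
    {w : K} (hw : Transcendental K₁ w) : IsPTPure O K₁ w := by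
  sorry

/-- **A2 (no shadow ⇒ pure)** — the criterion. Fix an algebraic closure `Ω ⊇ K` and an extension
`V` of `O`. If no element `θ ∈ Ω` algebraic over `K₁` is STRICTLY closer to `w` than every
element of `K₁` (Temkin: `w` is `K₁`-split; Kuhlmann 2022: `appr(w, K₁)` is not an algebraic
immediate approximation type), then `w` is PT-pure. Proof route: if `v(w − K₁)` has a maximum,
(a); otherwise the approximation type is immediate (Kuhlmann 2022, Lemma 3.7) and, by the
hypothesis and Thm. 3.16 (= Kaplansky 1942, Thm. 3), transcendental; then `K₁(w)|K₁` is immediate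
(Thm. 3.13) and Lemma 3.11 (tree: `kaplansky_condition_of_forall_exists_le`,
`valuation_eval_eq_of_kaplansky`) is (b). -/
theorem isPTPure_of_forall_exists_le (O : ValuationSubring K) (K₁ : IntermediateField k K)
    {w : K} (hw : Transcendental K₁ w)
    (Ω : Type) [Field Ω] [Algebra K Ω] [IsAlgClosure K Ω] (V : ValuationSubring Ω)
    (hV : V.comap (algebraMap K Ω) = O)
    (hss : ∀ θ : Ω, (∃ q : Polynomial K, q ≠ 0 ∧ (∀ i, q.coeff i ∈ K₁) ∧ Polynomial.aeval θ q = 0) →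
        ∃ c ∈ K₁, V.valuation (algebraMap K Ω (w - c)) ≤ V.valuation (algebraMap K Ω w - θ)) :
    IsPTPure O K₁ w := by
  sorry

/-- **A3 (Abhyankar block ⇒ pure).** If the block field `K₁` is finitely generated over the
perfect ground field `k`, `O` has rank one, and `K₁` has transcendence defect `0` over `k`
(Abhyankar), then every `w` transcendental over `K₁` is PT-pure: by the generalized stability
theorem (`Kuhlmann2010Stability_holds`, PROVED in tree) `K₁` is a defectless field, hence so is
`K₁ʰ` (`Kuhlmann2010DefectlessIffHenselization`, PROVED); a shadow `θ` of `w` would realise a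
bounded algebraic immediate approximation type over `K₁ʰ` (rank-one density,
`RankOneDensity.lean`), i.e. generate a proper immediate = defect extension of `K₁ʰ`
(Kuhlmann 2022, Lemma 3.11 ff.), contradiction; conclude by `isPTPure_of_forall_exists_le`. -/
theorem isPTPure_of_transcendenceDefect_eq_zero (p : ℕ) [Fact p.Prime] [CharP k p]
    [PerfectField k] (O : ValuationSubring K) [O.valuation.RankOne]
    (K₁ : IntermediateField k K) (hfg : K₁.FG)
    (hk₁ : ∀ c : k, algebraMap k K₁ c ∈ O.comap (algebraMap K₁ K))
    (hD : Literature.AlgebraicGeometry.Resolution.transcendenceDefect k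
      (O.comap (algebraMap K₁ K)) hk₁ = 0)
    {w : K} (hw : Transcendental K₁ w) : IsPTPure O K₁ w := by
  sorry

/-! ### Card B — additive data and re-pointing the frame -/

/-- **B1 (no two-cycle for integral data).** Inside `O`, the relation "`A(w)` is closer to the
block coordinate `y` than `A` of any `K₀(y)`-translate of `w`" (an inseparable / additive shadow
of `w` over `K₀(y)` with datum `y`) and the swapped relation for `y` over `K₀(w)` with datum `w`
cannot hold simultaneously, for ANY polynomials `A, B` over `K₀ ∩ O` without constant term
(Frobenius powers `X^{p^m}`, Artin–Schreier `X^p − X`, general `p`-polynomials): take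
`a := B(y)`, `b := A(w)`. So re-pointing the frame at the datum never bounces straight back. -/
theorem no_two_cycle (O : ValuationSubring K) (K₀ : IntermediateField k K)
    {y w : K} (hy : y ∈ O) (hw : w ∈ O)
    (A B : Polynomial K) (hA0 : A.eval 0 = 0) (hB0 : B.eval 0 = 0)
    (hAO : ∀ i, A.coeff i ∈ O) (hBO : ∀ i, B.coeff i ∈ O)
    (hAK₀ : ∀ i, A.coeff i ∈ K₀) (hBK₀ : ∀ i, B.coeff i ∈ K₀)
    (h1 : ∀ a ∈ IntermediateField.adjoin k ((K₀ : Set K) ∪ {y}),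
      O.valuation (A.eval w - y) < O.valuation (A.eval (w - a)))
    (h2 : ∀ b ∈ IntermediateField.adjoin k ((K₀ : Set K) ∪ {w}),
      O.valuation (B.eval y - w) < O.valuation (B.eval (y - b))) :
    False := by
  sorry

/-- **B2 (swap transfer).** Purity over a block field `F` is invariant under the `F`-affine
involution `X ↦ c − X` (`c ∈ F`): in the re-pointed frame, the old block coordinate
`y = A(w) − A(z)` (with `A(w) ∈ F = K₀(w, …)`) is pure iff the residual `A(z)` is. -/
theorem isPTPure_sub_left_iff (O : ValuationSubring K) (F : IntermediateField k K)
    {c : K} (hc : c ∈ F) (e : K) : IsPTPure O F (c - e) ↔ IsPTPure O F e := by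
  sorry

end Summit.ResolutionOfSingularities.ResolutionOfSingularities.Cruxes.PureTranscendentalFrames.Sketch
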